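import Literature.NumberTheory.EllipticCurves.LangHeightArchEstimate
import Literature.NumberTheory.EllipticCurves.LangHeightECFrontier
import Literature.NumberTheory.EllipticCurves.ComplexTorusAddProofs
import Literature.NumberTheory.EllipticCurves.ComplexPeriod
import Mathlib.Combinatorics.Pigeonhole
import Mathlib.Analysis.Normed.Group.InfiniteSum
import Mathlib.Analysis.SpecialFunctions.Complex.Log
import HarnessLib

/-!
# Petsche's archimedean step, proved from ATAEC VI.3.4 and Hindry–Silverman's Lemma 5

Topic `NumberTheory/EllipticCurves` (family `abc`, G06). Pure proofs (theorems only: no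
definitions, no named facts). This file discharges the named fact
`Literature.NumberTheory.EllipticCurves.Petsche2006_exists_subset_le_neronLocalHeight_real`
(`LangHeightSmallPoints.lean`; Petsche, New York J. Math. 12 (2006), proof of Prop. 7, the
archimedean paragraph) *relative to* the two named facts of `LangHeightArchEstimate.lean`:

* `neronLocalHeight_eq_neronFunction` — Silverman, *Advanced Topics*, Thm. VI.3.4 (the local height
  on `E(ℂ) ≅ ℂ/(ℤτ + ℤ)` is the Néron function `neronFunction τ`), and
* `Petsche2006_lemma5` — Hindry–Silverman's minoration `λ(r₁ + r₂τ) ≥ (1/288) max{1, log|j(τ)|}`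
  for `τ ∈ 𝒟`, `max |rᵢ| ≤ 1/24`,

records that the series defining `neronFunction` converges for every `z`
(`summable_neronFunction_term`, the API gap noted at the review of `LangHeightArchEstimate.lean`),
and records the resulting sharper frontier of the formal proof of
`szpiro_imp_langHeightLowerBoundConjecture` (Hindry–Silverman 1988, Thm. 0.3):
`szpiro_imp_langHeightLowerBoundConjecture_of_localHeightFacts`, conditional on Petsche's Lemma 3,
the Kodaira–Néron facts, ATAEC VI.3.4 and Lemma 5 only.

## The printed argument and its formalisation

Petsche (arXiv math/0508160, p. 6): *"Let `v₀` be an archimedean place … We then have a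
corresponding embedding `σ : E(k) ↪ ℂ/L`, where `L = ℤ + τℤ` is a normalized lattice, and
`|j(τ)| = |j_E|_{v₀}`. If `λ` denotes the Néron function on the complex torus, then
`λ_{v₀} = λ ∘ σ`. Divide the torus `ℂ/L` into the `24²` parallelograms … By the pigeonhole
principle there exists a set `Z ⊆ S` of `N` distinct points such that `σ(Z)` is contained in one
of the `24²` parallelograms … the difference `σ(P_i) − σ(P_j)` … Therefore, by Lemma 5 we have
`λ_{v₀}(P_i − P_j) ≥ (1/288) max{1, log|j_E|_{v₀}}` for all such pairs."* Over `k = ℚ`: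

1. `exists_mem_fd_mulLeft_g₂_eq_g₃_eq` (**proved**): for an elliptic curve `W/ℂ` there are
   `τ ∈ 𝒟` and `c ≠ 0` with `g₂(c(ℤτ + ℤ)) = c₄/12`, `g₃(c(ℤτ + ℤ)) = c₆/216` and `j(τ) = j(W)` —
   the Uniformization Theorem (`PeriodPair.uniformization_holds`, AEC VI.5.1), every lattice is
   `cΛ_τ` (`PeriodPair.exists_lattice_eq_mulLeft_ofUpperHalfPlane`), `SL₂(ℤ)` moves `τ` into `𝒟`
   (Mathlib `ModularGroup.exists_smul_mem_fd`) without changing `j` (`kleinJ_smul`), and lattices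
   with the same `j` are homothetic (Cox Thm. 10.9, `PeriodPair.exists_lattice_eq_mulLeft_of_j_eq`);
   then `σ⁻¹ : z ↦ u(cz)` with `u : ℂ →+ W(ℂ)` the analytic parametrisation of
   `PeriodPair.exists_addMonoidHom_of_g₂_g₃` (AEC VI.3.6(b), using `PeriodPair.toPoint_add_holds`),
   kernel exactly `ℤτ + ℤ`, onto.
2. `WeierstrassCurve.Affine.Point.neronLocalHeight_baseChange` (**proved**, ATAEC VI.1.1(c) for
   Tate's series): along any homomorphism `ι : E(F) →+ E(K)` that is `(x, y) ↦ (x, y)` on affine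
   points (Mathlib's `Point.baseChange ℚ ℂ` on `W.toAffine.Point`, `exists_baseChange_hom_complex`)
   and absolute values `v_K ∘ (F → K) = v_F`, Tate's series agree termwise
   (`naiveLocalHeight_baseChange`, `tateCorrection_baseChange`, `tateMu_baseChange`); so `λ_∞` on
   `E(ℚ)` is `λ_ℂ` (`|·|` on `ℂ`, `toAbsoluteValue_complex_algebraMap`) on `E(ℂ)`.
3. Lifts `z_P ∈ ℂ` of the points of `S` normalised to `0 ≤ r₁, r₂ < 1` in `z = r₁ + r₂τ`
   (`r₂ = Im z/Im τ`, `r₁ = Re z − r₂ Re τ`; `re_sub_add_im_div_mul`), the box map `P ↦ (⌊24r₁⌋, ⌊24r₂⌋) ∈ [0,24)²` and Mathlib's pigeonhole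
   `Finset.exists_lt_card_fiber_of_mul_lt_card_of_maps_to` (`24²·N < |S|`) give `N + 1` points in
   one box; for two of them `z_P − z_Q = r₁ + r₂τ` with `|rᵢ| < 1/24`, it lifts `P − Q ≠ O`
   (injectivity of `E(ℚ) → E(ℂ)`), so it is not in `ℤτ + ℤ`; then
   `λ_∞(P − Q) = λ_ℂ(u(c(z_P − z_Q))) = neronFunction τ (z_P − z_Q) ≥ (1/288) max{1, log|j(τ)|}`
   by (2), ATAEC VI.3.4 and Lemma 5, and `|j(τ)| = |j(W)|` (`WeierstrassCurve.map_j`).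

## References

* C. Petsche, New York J. Math. 12 (2006), 257–268, Lemma 5 and proof of Prop. 7.
* J. H. Silverman, *Advanced Topics in the Arithmetic of Elliptic Curves* (1994), Thm. VI.1.1,
  VI.3.4; *The Arithmetic of Elliptic Curves*, 2nd ed. (2009), Prop. VI.3.6, Thm. VI.5.1,
  Cor. VI.5.1.1.
* M. Hindry, J. H. Silverman, Invent. Math. 93 (1988), 419–450, Prop. 2.3, Thm. 0.3.
* D. A. Cox, *Primes of the form x² + ny²*, 2nd ed. (2013), Thm. 10.9.
-/

noncomputable section

open scoped UpperHalfPlane Modular Real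

open Complex IsDedekindDomain


namespace Literature.NumberTheory.EllipticCurves

/-! ### The series defining the Néron function converges for every `z` -/

open Filter in
/-- For `‖x‖ ≤ ½`: `|log|1 − x|| ≤ 2‖x‖` (from `1 − ‖x‖ ≤ |1 − x| ≤ 1 + ‖x‖`,
`log y ≤ y − 1` and `1 − y⁻¹ ≤ log y`). [folklore] -/
theorem abs_log_norm_one_sub_le {x : ℂ} (hx : ‖x‖ ≤ 1 / 2) : |Real.log ‖1 - x‖| ≤ 2 * ‖x‖ := by
  have h0 : 0 ≤ ‖x‖ := norm_nonneg x
  have h1 : 1 - ‖x‖ ≤ ‖1 - x‖ := by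
    have := norm_sub_norm_le (1 : ℂ) x
    rwa [norm_one] at this
  have h2 : ‖1 - x‖ ≤ 1 + ‖x‖ := by
    have := norm_sub_le (1 : ℂ) x
    rwa [norm_one] at this
  have hpos : 0 < ‖1 - x‖ := lt_of_lt_of_le (by linarith) h1
  rw [abs_le]
  constructor
  · have h3 := Real.one_sub_inv_le_log_of_pos hpos
    have h4 : ‖1 - x‖⁻¹ ≤ (1 - ‖x‖)⁻¹ := by
      rw [inv_le_inv₀ hpos (by linarith)]
      exact h1
    have h5 : (1 - ‖x‖)⁻¹ ≤ 1 + 2 * ‖x‖ := by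
      rw [inv_le_iff_one_le_mul₀ (by linarith)]
      nlinarith
    linarith
  · have := Real.log_le_sub_one_of_pos hpos
    linarith

open Filter Topology in
/-- **The series in `neronFunction` converges absolutely for every `z ∈ ℂ`** (ATAEC Thm. VI.3.4:
`|q| < 1`, so `qⁿu^{±1} → 0` geometrically and `log|1 − qⁿu^{±1}| = O(|q|ⁿ)`); in particular
the `tsum` in the definition of `neronFunction τ z` is a genuine sum, for all `z` (on the lattice
one factor vanishes for one `n` at most, which does not affect summability).
[cite: Silverman1994, Thm VI.3.4] -/
theorem summable_neronFunction_term (τ : ℍ) (z : ℂ) :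
    Summable fun n : ℕ => Real.log ‖(1 - cexp (2 * π * I * τ) ^ (n + 1) * cexp (2 * π * I * z)) *
      (1 - cexp (2 * π * I * τ) ^ (n + 1) * (cexp (2 * π * I * z))⁻¹)‖ := by
  set q := cexp (2 * π * I * τ) with hq
  set u := cexp (2 * π * I * z) with hu
  have hq1 : ‖q‖ < 1 := UpperHalfPlane.norm_exp_two_pi_I_lt_one τ
  have hq0 : 0 ≤ ‖q‖ := norm_nonneg q
  set M : ℝ := max ‖u‖ ‖u⁻¹‖ with hM
  have hev : ∀ᶠ n : ℕ in atTop, ‖q‖ ^ (n + 1) * M ≤ 1 / 2 := by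
    have ht : Tendsto (fun n : ℕ => ‖q‖ ^ (n + 1) * M) atTop (𝓝 (0 * M)) :=
      ((tendsto_pow_atTop_nhds_zero_of_lt_one hq0 hq1).comp (tendsto_add_atTop_nat 1)).mul_const M
    rw [zero_mul] at ht
    exact ht.eventually (eventually_le_nhds (by norm_num : (0 : ℝ) < 1 / 2))
  refine Summable.of_norm_bounded_eventually_nat
    (g := fun n : ℕ => 4 * M * ‖q‖ * ‖q‖ ^ n) ?_ ?_
  · exact (summable_geometric_of_lt_one hq0 hq1).mul_left _
  · filter_upwards [hev] with n hn
    have hb : ∀ w : ℂ, ‖w‖ ≤ M → ‖q ^ (n + 1) * w‖ ≤ 1 / 2 ∧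
        |Real.log ‖1 - q ^ (n + 1) * w‖| ≤ 2 * (‖q‖ ^ (n + 1) * M) := by
      intro w hw
      have hqw : ‖q ^ (n + 1) * w‖ ≤ ‖q‖ ^ (n + 1) * M := by
        rw [norm_mul, norm_pow]
        exact mul_le_mul_of_nonneg_left hw (pow_nonneg hq0 _)
      refine ⟨hqw.trans hn, (abs_log_norm_one_sub_le (hqw.trans hn)).trans ?_⟩
      linarith
    obtain ⟨hau, hlu⟩ := hb u (le_max_left _ _)
    obtain ⟨hau', hlu'⟩ := hb u⁻¹ (le_max_right _ _)
    have hne : ∀ w : ℂ, ‖q ^ (n + 1) * w‖ ≤ 1 / 2 → ‖1 - q ^ (n + 1) * w‖ ≠ 0 := by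
      intro w hw h0
      rw [norm_eq_zero, sub_eq_zero] at h0
      rw [← h0, norm_one] at hw
      norm_num at hw
    rw [Real.norm_eq_abs, norm_mul, Real.log_mul (hne u hau) (hne u⁻¹ hau')]
    calc |Real.log ‖1 - q ^ (n + 1) * u‖ + Real.log ‖1 - q ^ (n + 1) * u⁻¹‖|
        ≤ |Real.log ‖1 - q ^ (n + 1) * u‖| + |Real.log ‖1 - q ^ (n + 1) * u⁻¹‖| := abs_add_le _ _
      _ ≤ 2 * (‖q‖ ^ (n + 1) * M) + 2 * (‖q‖ ^ (n + 1) * M) := add_le_add hlu hlu'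
      _ = 4 * M * ‖q‖ * ‖q‖ ^ n := by ring

end Literature.NumberTheory.EllipticCurves

namespace WeierstrassCurve.Affine.Point

/-! ### Tate's series under an extension of valued fields (ATAEC VI.1.1(c)) -/

section BaseChange

variable {F K : Type*} [Field F] [Field K] [DecidableEq F] [DecidableEq K] [Algebra F K]
  {vF : AbsoluteValue F ℝ} {vK : AbsoluteValue K ℝ} {W : WeierstrassCurve F}
  (ι : W.toAffine.Point →+ (W.baseChange K).toAffine.Point)
  (hι : ∀ {x y : F} (h : W.toAffine.Nonsingular x y),
    ∃ h', ι (some x y h) = some (algebraMap F K x) (algebraMap F K y) h')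
  (hv : ∀ x : F, vK (algebraMap F K x) = vF x)

/-! Here `ι : E(F) →+ E(K)` is any homomorphism given on affine points by
`(x, y) ↦ (x, y)` — Mathlib's `WeierstrassCurve.Affine.Point.baseChange F K` is such a map
(its values on affine points hold by `rfl`); quantifying over `ι` keeps the statements on
`W.toAffine.Point` itself. -/

include hι hv

/-- `λ₁` is compatible with base change when `v_K` extends `v_F` (same formula
`½ log⁺|x(P)|`). [cite: Silverman1994, Thm VI.1.1(c)] -/
theorem naiveLocalHeight_baseChange (P : W.toAffine.Point) :
    naiveLocalHeight vK (ι P) = naiveLocalHeight vF P := by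
  rcases P with _ | ⟨x, y, h⟩
  · show naiveLocalHeight vK (ι 0) = naiveLocalHeight vF 0
    rw [_root_.map_zero]
    rfl
  · obtain ⟨h', e⟩ := hι h
    rw [e, naiveLocalHeight_some, naiveLocalHeight_some, hv]

/-- Tate's correction `f` is compatible with base change when `v_K` extends `v_F` (`φ`, `ψ`, `Δ`
are base-changed coefficientwise). [cite: Silverman1994, Lemma VI.1.2] -/
theorem tateCorrection_baseChange (P : W.toAffine.Point) :
    tateCorrection vK (ι P) = tateCorrection vF P := by
  have hΔ : (W.baseChange K).Δ = algebraMap F K W.Δ := W.map_Δ _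
  rcases P with _ | ⟨x, y, h⟩
  · show tateCorrection vK (ι 0) = tateCorrection vF 0
    rw [_root_.map_zero, tateCorrection_zero, tateCorrection_zero, hΔ, hv]
  · obtain ⟨h', e⟩ := hι h
    have hΦ : ((W.baseChange K).Φ 2).eval (algebraMap F K x) = algebraMap F K ((W.Φ 2).eval x) := by
      rw [WeierstrassCurve.baseChange, WeierstrassCurve.map_Φ, Polynomial.eval_map_apply]
    have hΨ : (W.baseChange K).Ψ₂Sq.eval (algebraMap F K x) = algebraMap F K (W.Ψ₂Sq.eval x) := by
      rw [WeierstrassCurve.baseChange, WeierstrassCurve.map_Ψ₂Sq, Polynomial.eval_map_apply]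
    rw [e, tateCorrection_some, tateCorrection_some, hΦ, hΨ, hΔ, hv, hv, hv, hv]

/-- Tate's series `μ` is compatible with base change when `v_K` extends `v_F` (termwise, using
`ι(2ⁿP) = 2ⁿ ι(P)`; the group laws elaborated with the classical and with the given decidable
equality agree by `Subsingleton.elim`). [cite: Silverman1994, Prop VI.1.3] -/
theorem tateMu_baseChange (P : W.toAffine.Point) : tateMu vK (ι P) = tateMu vF P := by
  unfold tateMu
  refine tsum_congr fun n => ?_
  congr 1
  rw [← tateCorrection_baseChange ι hι hv]
  congr 1
  convert (map_nsmul ι (2 ^ n) P).symm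

/-- **ATAEC Thm. VI.1.1(c)** for Tate's series: if the absolute value `v_K` of `K` extends `v_F`
along `F → K`, then `λ_{v_K}(P) = λ_{v_F}(P)` for `P ∈ E(F) ⊆ E(K)` (the series agree termwise).
[cite: Silverman1994, Thm VI.1.1(c)] -/
theorem neronLocalHeight_baseChange (P : W.toAffine.Point) :
    neronLocalHeight vK (ι P) = neronLocalHeight vF P := by
  rw [neronLocalHeight, neronLocalHeight, naiveLocalHeight_baseChange ι hι hv,
    tateMu_baseChange ι hι hv]

end BaseChange

/-- `|x|_ℂ = |x|_∞` for `x ∈ ℚ ⊂ ℂ`. [folklore] -/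
theorem toAbsoluteValue_complex_algebraMap (x : ℚ) :
    NormedField.toAbsoluteValue ℂ (algebraMap ℚ ℂ x) = Rat.AbsoluteValue.real x := by
  rw [Rat.AbsoluteValue.real_eq_abs, Rat.cast_abs, eq_ratCast]
  exact Complex.norm_ratCast x

/-- The base change `E(ℚ) →+ E(ℂ)` on `W.toAffine.Point` (Mathlib's
`WeierstrassCurve.Affine.Point.baseChange ℚ ℂ` along `W.baseChange ℚ = W`): an injective
homomorphism given by `(x, y) ↦ (x, y)` on affine points. [folklore] -/
theorem exists_baseChange_hom_complex (W : WeierstrassCurve ℚ) :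
    ∃ ι : W.toAffine.Point →+ (W.baseChange ℂ).toAffine.Point, Function.Injective ι ∧
      ∀ {x y : ℚ} (h : W.toAffine.Nonsingular x y),
        ∃ h', ι (some x y h) = some (algebraMap ℚ ℂ x) (algebraMap ℚ ℂ y) h' :=
  ⟨baseChange (W' := W) ℚ ℂ, map_injective (W' := W) _, fun _ => ⟨_, rfl⟩⟩

end WeierstrassCurve.Affine.Point

namespace Literature.NumberTheory.EllipticCurves

open _root_.PeriodPair Literature.NumberTheory.EllipticCurves.ModularForms
open _root_.WeierstrassCurve.Affine.Point

/-! ### Complex uniformisation by a normalised lattice (AEC VI.5.1, VI.3.6; Cox 10.9) -/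

/-- **Uniformisation by a normalised lattice.** For an elliptic curve `W/ℂ` there are `τ` in the
standard fundamental domain `𝒟` of `SL₂(ℤ)` and `c ≠ 0` such that `c(ℤτ + ℤ)` is a period lattice
of `W` (`g₂ = c₄/12`, `g₃ = c₆/216`), and then `j(τ) = j(W)` (Silverman AEC Thm. VI.5.1 and
Cor. VI.5.1.1 with Serre VII §2.2: every lattice is `SL₂(ℤ)`-equivalent to a `cΛ_τ`, `τ ∈ 𝒟`).
[cite: SilvermanAEC2009, Cor VI.5.1.1] -/
theorem exists_mem_fd_mulLeft_g₂_eq_g₃_eq (W : WeierstrassCurve ℂ) [W.IsElliptic] :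
    ∃ (τ : ℍ) (c : ℂ) (hc : c ≠ 0), τ ∈ 𝒟 ∧
      ((ofUpperHalfPlane τ).mulLeft c hc).g₂ = W.c₄ / 12 ∧
      ((ofUpperHalfPlane τ).mulLeft c hc).g₃ = W.c₆ / 216 ∧ kleinJ τ = W.j := by
  obtain ⟨L, h₂, h₃⟩ := W.exists_periodPair_of_isElliptic uniformization_holds
  obtain ⟨τ₀, c₀, hc₀, hL⟩ := L.exists_lattice_eq_mulLeft_ofUpperHalfPlane
  obtain ⟨γ, hγ⟩ := ModularGroup.exists_smul_mem_fd τ₀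
  have hjτ : (ofUpperHalfPlane (γ • τ₀)).j = L.j := by
    rw [← kleinJ_eq_periodPair_j, kleinJ_smul, kleinJ_eq_periodPair_j, j_eq_of_lattice_eq hL,
      j_mulLeft]
  obtain ⟨c, hc, hLc⟩ := exists_lattice_eq_mulLeft_of_j_eq hjτ
  refine ⟨γ • τ₀, c, hc, hγ, ?_, ?_, ?_⟩
  · rw [← g₂_eq_of_lattice_eq hLc, h₂]
  · rw [← g₃_eq_of_lattice_eq hLc, h₃]
  · rw [kleinJ_eq_periodPair_j, hjτ, j_eq_weierstrassCurve_j h₂ h₃]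

/-! ### Real coordinates `z = r₁ + r₂τ` with respect to the basis `(1, τ)` -/

section Coord

variable (τ : ℍ)

/-- `z = r₁ + r₂τ` with `r₂ = Im z / Im τ`, `r₁ = Re z − r₂ Re τ`. [folklore] -/
theorem re_sub_add_im_div_mul (z : ℂ) :
    ((z.re - z.im / τ.im * τ.re : ℝ) : ℂ) + (z.im / τ.im : ℝ) * (τ : ℂ) = z := by
  have hτ : τ.im ≠ 0 := τ.im_pos.ne'
  apply Complex.ext
  · simp
  · simp only [Complex.add_im, Complex.ofReal_im, Complex.mul_im, Complex.ofReal_re,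
      UpperHalfPlane.coe_im, UpperHalfPlane.coe_re, zero_add, zero_mul, add_zero]
    field_simp

/-- The `τ`-coordinate of `z − (m + nτ)` is that of `z` minus `n`. [folklore] -/
theorem im_sub_intCast_div (z : ℂ) (m n : ℤ) :
    (z - ((m : ℂ) + n * (τ : ℂ))).im / τ.im = z.im / τ.im - n := by
  have hτ : τ.im ≠ 0 := τ.im_pos.ne'
  simp [sub_div, hτ]

/-- The `1`-coordinate of `z − (m + nτ)` is that of `z` minus `m`. [folklore] -/
theorem re_sub_intCast_sub (z : ℂ) (m n : ℤ) :
    (z - ((m : ℂ) + n * (τ : ℂ))).re - (z - ((m : ℂ) + n * (τ : ℂ))).im / τ.im * τ.re =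
      (z.re - z.im / τ.im * τ.re) - m := by
  rw [im_sub_intCast_div]
  simp only [Complex.sub_re, Complex.add_re, Complex.intCast_re, Complex.mul_re, Complex.intCast_im,
    UpperHalfPlane.coe_re, UpperHalfPlane.coe_im, zero_mul, sub_zero]
  ring

/-- `m + nτ ∈ ℤτ + ℤ`. [folklore] -/
theorem intCast_add_intCast_mul_mem_lattice (m n : ℤ) :
    (m : ℂ) + n * (τ : ℂ) ∈ (ofUpperHalfPlane τ).lattice :=
  mem_lattice.mpr ⟨n, m, by simp [add_comm]⟩

omit τ in
/-- Two reals with the same value of `⌊24 r⌋` differ by less than `1/24`. [folklore] -/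
theorem abs_sub_lt_of_floor_mul_eq {a b : ℝ} (h : ⌊24 * a⌋ = ⌊24 * b⌋) : |a - b| < 1 / 24 := by
  have h1 := Int.abs_sub_lt_one_of_floor_eq_floor h
  rw [← mul_sub, abs_mul, abs_of_pos (by norm_num : (0 : ℝ) < 24)] at h1
  linarith [abs_nonneg (a - b)]

end Coord

/-! ### Petsche's archimedean step from ATAEC VI.3.4 and Lemma 5 -/

/-- **Petsche 2006, proof of Prop. 7, the archimedean step over `ℚ`**
(`Petsche2006_exists_subset_le_neronLocalHeight_real`: among `24²N + 1` rational points some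
`N + 1` have all differences with `λ_∞ ≥ (1/288) max{1, log|j_E|}`), **proved** from ATAEC
Thm. VI.3.4 (`neronLocalHeight_eq_neronFunction`) and Lemma 5 (`Petsche2006_lemma5`): complex
uniformisation by a normalised lattice with `|j(τ)| = |j_E|` (`exists_mem_fd_mulLeft_g₂_eq_g₃_eq`,
`PeriodPair.exists_addMonoidHom_of_g₂_g₃`), `λ_∞ = λ_ℂ` on `E(ℚ)`
(`neronLocalHeight_baseChange`), pigeonhole on the boxes `(⌊24r₁⌋, ⌊24r₂⌋)` of
normalised lifts, and Lemma 5 at the difference of two lifts in one box.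
[cite: Petsche2006, proof of Prop. 7] -/
theorem Petsche2006_exists_subset_le_neronLocalHeight_real_of
    (hU : neronLocalHeight_eq_neronFunction) (h5 : Petsche2006_lemma5) :
    Petsche2006_exists_subset_le_neronLocalHeight_real := by
  intro W _ S N hS
  -- complex uniformisation `z ↦ u (c z)`, `ℂ/(ℤτ + ℤ) ≅ E(ℂ)`, with `τ ∈ 𝒟`, `j(τ) = j(E)`
  obtain ⟨τ, c, hc, hτ, h₂, h₃, hj⟩ := exists_mem_fd_mulLeft_g₂_eq_g₃_eq (W.baseChange ℂ)
  obtain ⟨u, hker, hsurj, hspec⟩ :=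
    exists_addMonoidHom_of_g₂_g₃ (toPoint_add_holds ((ofUpperHalfPlane τ).mulLeft c hc)) h₂ h₃
  have hker' : ∀ z : ℂ, u (c * z) = 0 ↔ z ∈ (ofUpperHalfPlane τ).lattice := by
    intro z
    rw [← AddMonoidHom.mem_ker, ← SetLike.mem_coe, hker, SetLike.mem_coe]
    exact mul_mem_mulLeft_lattice
  obtain ⟨ι, hιinj, hι⟩ := exists_baseChange_hom_complex W
  -- normalised lifts of the rational points: `u (c z_P) = P`, `z_P = r₁ + r₂ τ`, `0 ≤ rᵢ < 1`
  have hlift : ∀ P : W.toAffine.Point, ∃ z : ℂ, u (c * z) = ι P ∧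
      0 ≤ z.re - z.im / τ.im * τ.re ∧ z.re - z.im / τ.im * τ.re < 1 ∧
      0 ≤ z.im / τ.im ∧ z.im / τ.im < 1 := by
    intro P
    obtain ⟨w, hw⟩ := hsurj (ι P)
    set z₀ : ℂ := c⁻¹ * w with hz₀
    refine ⟨z₀ - ((⌊z₀.re - z₀.im / τ.im * τ.re⌋ : ℂ) + (⌊z₀.im / τ.im⌋ : ℂ) * (τ : ℂ)),
      ?_, ?_, ?_, ?_, ?_⟩
    · rw [mul_sub, map_sub, (hker' _).mpr (intCast_add_intCast_mul_mem_lattice τ _ _), sub_zero,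
        hz₀, mul_inv_cancel_left₀ hc, hw]
    · rw [re_sub_intCast_sub]
      exact Int.fract_nonneg _
    · rw [re_sub_intCast_sub]
      exact Int.fract_lt_one _
    · rw [im_sub_intCast_div]
      exact Int.fract_nonneg _
    · rw [im_sub_intCast_div]
      exact Int.fract_lt_one _
  choose lift hlift_eq hlift₁ hlift₁' hlift₂ hlift₂' using hlift
  -- pigeonhole over the `24²` boxes
  let box : W.toAffine.Point → ℤ × ℤ := fun P =>
    (⌊24 * ((lift P).re - (lift P).im / τ.im * τ.re)⌋, ⌊24 * ((lift P).im / τ.im)⌋)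
  have hbox : ∀ P ∈ S, box P ∈ Finset.Ico (0 : ℤ) 24 ×ˢ Finset.Ico (0 : ℤ) 24 := by
    intro P _
    simp only [box, Finset.mem_product, Finset.mem_Ico, Int.floor_nonneg, Int.floor_lt,
      Int.cast_ofNat]
    refine ⟨⟨?_, ?_⟩, ?_, ?_⟩
    · exact mul_nonneg (by norm_num) (hlift₁ P)
    · linarith [hlift₁' P]
    · exact mul_nonneg (by norm_num) (hlift₂ P)
    · linarith [hlift₂' P]
  have hcard : (Finset.Ico (0 : ℤ) 24 ×ˢ Finset.Ico (0 : ℤ) 24).card * N < S.card := by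
    have h576 : (Finset.Ico (0 : ℤ) 24 ×ˢ Finset.Ico (0 : ℤ) 24).card = 24 ^ 2 := by simp
    rw [h576]
    omega
  obtain ⟨b, -, hb⟩ := Finset.exists_lt_card_fiber_of_mul_lt_card_of_maps_to hbox hcard
  obtain ⟨Z, hZF, hZcard⟩ := Finset.exists_subset_card_eq (Nat.succ_le_of_lt hb)
  refine ⟨Z, fun P hP => (Finset.mem_filter.mp (hZF hP)).1, hZcard, ?_⟩
  intro P hP Q hQ hPQ
  have hbP : box P = b := (Finset.mem_filter.mp (hZF hP)).2
  have hbQ : box Q = b := (Finset.mem_filter.mp (hZF hQ)).2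
  have hbPQ : box P = box Q := hbP.trans hbQ.symm
  simp only [box, Prod.mk.injEq] at hbPQ
  -- the difference `d = r₁ + r₂τ` of the two lifts: `|rᵢ| < 1/24`, and `d` lifts `P − Q ≠ O`
  set d : ℂ := lift P - lift Q with hd
  set r₁ : ℝ := d.re - d.im / τ.im * τ.re with hr₁
  set r₂ : ℝ := d.im / τ.im with hr₂
  have hr₁' : r₁ = ((lift P).re - (lift P).im / τ.im * τ.re) -
      ((lift Q).re - (lift Q).im / τ.im * τ.re) := by
    simp only [hr₁, hr₂, hd, Complex.sub_re, Complex.sub_im, sub_div]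
    ring
  have hr₂' : r₂ = (lift P).im / τ.im - (lift Q).im / τ.im := by
    simp only [hr₂, hd, Complex.sub_im, sub_div]
  have hsmall : max |r₁| |r₂| ≤ 1 / 24 := by
    rw [hr₁', hr₂']
    exact max_le (abs_sub_lt_of_floor_mul_eq hbPQ.1).le (abs_sub_lt_of_floor_mul_eq hbPQ.2).le
  have hud : u (c * d) = ι (P - Q) := by
    rw [hd, mul_sub, map_sub, hlift_eq, hlift_eq, map_sub]
  have hdnot : d ∉ (ofUpperHalfPlane τ).lattice := by
    intro hmem
    have h0 : ι (P - Q) = ι 0 := by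
      rw [← hud, (hker' d).mpr hmem, _root_.map_zero]
    exact hPQ (sub_eq_zero.mp (hιinj h0))
  have hdr : (r₁ : ℂ) + r₂ * (τ : ℂ) = d := re_sub_add_im_div_mul τ d
  have hd0 : (r₁ : ℂ) + r₂ * (τ : ℂ) ≠ 0 := by
    rw [hdr]
    intro h0
    rw [h0] at hdnot
    exact hdnot (zero_mem _)
  -- assemble: `λ_∞(P − Q) = λ_ℂ(u(c d)) = neronFunction τ d ≥ (1/288) max{1, log|j(τ)|}`
  have hlam : (P - Q).neronLocalHeight Rat.AbsoluteValue.real = neronFunction τ d := by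
    rw [← neronLocalHeight_baseChange ι hι toAbsoluteValue_complex_algebraMap, ← hud]
    exact hU (W.baseChange ℂ) τ c hc h₂ h₃ u hspec d hdnot
  have hjn : Real.log ‖kleinJ τ‖ = Real.log |((W.j : ℚ) : ℝ)| := by
    rw [hj, show (W.baseChange ℂ).j = algebraMap ℚ ℂ W.j from W.map_j _, eq_ratCast,
      Complex.norm_ratCast]
  calc 1 / 288 * max 1 (Real.log |((W.j : ℚ) : ℝ)|)
      = 1 / 288 * max 1 (Real.log ‖kleinJ τ‖) := by rw [hjn]
    _ ≤ neronFunction τ ((r₁ : ℂ) + r₂ * (τ : ℂ)) := h5 τ hτ r₁ r₂ hsmall hd0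
    _ = neronFunction τ d := by rw [hdr]
    _ = (P - Q).neronLocalHeight Rat.AbsoluteValue.real := hlam.symm

/-! ### The frontier of the formal proof of Szpiro ⇒ Lang over `ℚ` -/

/-- **Szpiro ⇒ Lang's height lower bound over `ℚ`, conditional on the local height facts only**
(`szpiro_imp_langHeightLowerBoundConjecture`; Hindry–Silverman 1988, Thm. 0.3): from Petsche's
Lemma 3 (`h3`, Tate uniformisation at the finite places), the Kodaira–Néron facts of
`KodairaNeron.lean` at the local minimal models (`h4`, `hsplit`), ATAEC Thm. VI.3.4 (`hU`, the
local height on `E(ℂ)` is the Néron function) and Hindry–Silverman's Lemma 5 (`h5`). Everything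
else — Tate's Lemma VI.1.2, the local decomposition VI.2.1, the non-archimedean estimate, the
archimedean pigeonhole step, Prop. 7, Thm. 2 and the Szpiro-ratio bound — is proved in the tree.
[cite: HindrySilverman1988, Thm 0.3] -/
theorem szpiro_imp_langHeightLowerBoundConjecture_of_localHeightFacts
    (h3 : Petsche2006_lemma3)
    (h4 : ∀ (W : WeierstrassCurve ℚ) (v : HeightOneSpectrum ℤ),
      (W.localMinimalModel v).index_goodReductionSubgroup_le_four (v.adicCompletionIntegers ℚ))
    (hsplit : ∀ (W : WeierstrassCurve ℚ) (v : HeightOneSpectrum ℤ),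
      (W.localMinimalModel v).index_goodReductionSubgroup_of_hasSplitMultiplicativeReduction
        (v.adicCompletionIntegers ℚ))
    (hU : neronLocalHeight_eq_neronFunction) (h5 : Petsche2006_lemma5) :
    szpiro_imp_langHeightLowerBoundConjecture :=
  szpiro_imp_langHeightLowerBoundConjecture_of_localHeightTheory h3 h4 hsplit
    (Petsche2006_exists_subset_le_neronLocalHeight_real_of hU h5)

/-- **Petsche 2006, Prop. 7 over `ℚ`, conditional on the same local height facts.**
[cite: Petsche2006, Prop. 7] -/
theorem Petsche2006_card_smallPoints_le_of_localHeightFacts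
    (h3 : Petsche2006_lemma3)
    (h4 : ∀ (W : WeierstrassCurve ℚ) (v : HeightOneSpectrum ℤ),
      (W.localMinimalModel v).index_goodReductionSubgroup_le_four (v.adicCompletionIntegers ℚ))
    (hsplit : ∀ (W : WeierstrassCurve ℚ) (v : HeightOneSpectrum ℤ),
      (W.localMinimalModel v).index_goodReductionSubgroup_of_hasSplitMultiplicativeReduction
        (v.adicCompletionIntegers ℚ))
    (hU : neronLocalHeight_eq_neronFunction) (h5 : Petsche2006_lemma5) :
    Petsche2006_card_smallPoints_le :=
  Petsche2006_card_smallPoints_le_of_localHeightTheory h3 h4 hsplit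
    (Petsche2006_exists_subset_le_neronLocalHeight_real_of hU h5)

end Literature.NumberTheory.EllipticCurves

end
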